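import Summits.BirchSwinnertonDyer.BirchSwinnertonDyer.Theorems.KimAtThreeDeepLowerOffStratumLevelLoweringVatsalStabRows
import Literature.NumberTheory.EllipticCurves.HidaFamilyMembersProofs
import Literature.NumberTheory.EllipticCurves.NewformsSpanProofs
import Literature.NumberTheory.EllipticCurves.NewformsOldNewProofs
import Literature.NumberTheory.EllipticCurves.Gamma1NewformLSeriesProofs
import Literature.NumberTheory.EllipticCurves.HeckeOperatorsAdjointProofs
import Literature.NumberTheory.EllipticCurves.NewformsLevelEqOfHeckeEigenvalueEqProofs
import Literature.NumberTheory.EllipticCurves.NewformsEqOfHeckeEigenvalueEqProofs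
import HarnessLib

/-!
# Route `KimAtThreeKolyvagin` (rung W2), crux `DeepLowerAtThreeOffKatoStratum` (item 19679), registered
# stub `stub_nonAdditive`, ROAD (b): VATSAL'S CONDITION 1 DISCHARGED — for every NEWFORM on `Γ₀(N)`, and for
# the `q`-stabilised old form `ι₁ g − β ι_q g` of a newform `g` whenever the two roots `α ≠ β` are distinct

Cell `bsd-addord`, seat `bsd-addord-w2-acc2` (PROGRAMME PART 1b, ACCEL-LIST row (2)), gen 5; item
`stmt-BirchSwinnertonDyer-19679` (OWNER w2-c2 assembles; `--supports`, closes nothing). The ROAD (b) row theorems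
(`…LevelLoweringVatsalStabRows`, `…VatsalIharaRows`) display Vatsal's Condition 1
(`HasSimpleHeckeGenEigenspace`, Vatsal 1999 (1.2): the generalised Hecke eigenspace of the eigencharacter is a
line) for the newform `D₀.f` and for the stabilised form `g' = ι₁ g − β ι_q g` — residual (R2) of the cell's
ledger. THIS FILE proves both from the tree's Atkin–Lehner theory (theorems only, no definition, no fact):

* §1 `heckeT_apply_eq_smul_of_pow_apply_eq_zero` — at a prime `ℓ ∤ N` a GENERALISED `T_ℓ`-eigenvector is an
  honest one (`T_ℓ` is Petersson-self-adjoint: `heckeT_selfAdjoint_holds`, Diamond–Shurman Thm. 5.5.3, and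
  `maxGenEigenspace_eq_eigenspace_of_selfAdjoint`); `iota_one_eq` (`ι₁ = id`);
  `hasSimpleHeckeGenEigenspace_of_isNewform0` — **(R2a): Condition 1 holds for every newform** («The first
  condition will be satisfied if … new of level `M`», Vatsal p. 398): a generalised eigenvector for the
  eigencharacter of `f` is a `T_ℓ`-eigenvector off `N`, hence (Atkin–Lehner basis + strong multiplicity one,
  `exists_isNewform0_mem_span_of_eigenpacket`, `IsNewform0.level_eq_of_heckeEigenvalue_eq_holds`,
  `IsNewform0.eq_of_heckeEigenvalue_eq_holds`) a combination of the `[α_d] f`, `N d ∣ N`, i.e. of `f` alone.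
* §2 `hasSimpleHeckeGenEigenspace_stab_of_ne` — **(R2b): Condition 1 for `g' = ι₁ g − β ι_q g`** (`g` a newform
  of level `M`, `q ∤ M` prime, `β² − a_q(g)β + q = 0`) **provided `α = a_q(g) − β ≠ β`**: a generalised
  eigenvector lies (same two theorems) in the `q`-old plane `ℂι₁g ⊕ ℂι_q g = ℂg'_β ⊕ ℂg'_α` on which
  `U_q g'_β = α g'_β`, `U_q g'_α = β g'_α` (`heckeT_stab_self`); a power of `U_q − α` kills only `ℂ g'_β`.
  (For `α = β` the plane is a Jordan block and Condition 1 FAILS; in weight `2` this does not happen —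
  Coleman–Edixhoven 1998, Thm. 2.1 — and it is trivially excluded when `α ≢ β` residually, §3.)
* §3 `exists_root_valuation_sub_lt_one` — a root `β ≡ q (mod 𝔪)` of `X² − a_q(g)X + q` when
  `a_q(g) ≡ q + 1` (the residual roots are `{1, q}`; no Hensel); `sub_ne_of_not_one_mod_three` — `α ≠ β` is
  FREE when `q ≢ 1 (mod 3)` (`α ≡ 1`, `β ≡ q`).

## References

* V. Vatsal, *Canonical periods and congruence formulae*, Duke Math. J. 98 (1999), (1.2) Condition 1. [Vatsal1999]
* A. O. L. Atkin, J. Lehner, Math. Ann. 185 (1970), Thm. 4, Thm. 5. [AtkinLehner1970]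
* F. Diamond, J. Shurman, *A First Course in Modular Forms* (2005), Thm. 5.5.3, Prop. 5.6.2, Thm. 5.8.2–5.8.3.
  [DiamondShurman2005]
* R. F. Coleman, B. Edixhoven, *On the semi-simplicity of the `U_p`-operator on modular forms*, Math. Ann. 310
  (1998) 119–127, Thm. 2.1. [ColemanEdixhoven1998]
-/

set_option autoImplicit false
-- the Theorems namespace of a single-conjunct summit repeats the summit name by design (D-0017)
set_option linter.dupNamespace false

noncomputable section

open scoped MatrixGroups ModularForm Classical NNReal

open CongruenceSubgroup WeierstrassCurve Literature.NumberTheory.EllipticCurves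
  Literature.NumberTheory.EllipticCurves.ModularForms
open UpperHalfPlane hiding I

namespace Summit.BirchSwinnertonDyer.BirchSwinnertonDyer.Theorems.KimAtThreeDeepLowerOffStratumLevelLoweringConditionOne

open Summit.BirchSwinnertonDyer.BirchSwinnertonDyer.Theorems.KimAtThreeDeepLowerOffStratumLevelLoweringVatsal
open Summit.BirchSwinnertonDyer.BirchSwinnertonDyer.Theorems.KimAtThreeDeepLowerOffStratumLevelLoweringVatsalStab
open Summit.BirchSwinnertonDyer.BirchSwinnertonDyer.Theorems.KimAtThreeDeepLowerOffStratumLevelLoweringVatsalStabRows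

/-! ### §1 Generalised eigenvectors off the level; Condition 1 for newforms -/

section Newform

variable {N : ℕ} [NeZero N] {k : ℤ}

/-- **At a prime `ℓ ∤ N` a generalised `T_ℓ`-eigenvector in `S_k(Γ₀(N))` is an honest eigenvector**: `T_ℓ` is
self-adjoint for the (definite, Hermitian) Petersson product, so `ker (T_ℓ − μ)ⁿ = ker (T_ℓ − μ)`
(Diamond–Shurman Thm. 5.5.3–5.5.4; `heckeT_selfAdjoint_holds`, `maxGenEigenspace_eq_eigenspace_of_selfAdjoint`).
[cite: DiamondShurman2005, Thm. 5.5.3] -/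
theorem heckeT_apply_eq_smul_of_pow_apply_eq_zero {ℓ : ℕ} [NeZero ℓ] (hℓ : ℓ.Prime) (hℓN : ¬ ℓ ∣ N) {μ : ℂ}
    {h : CuspForm (Gamma0 N) k} {n : ℕ}
    (hn : ((heckeT (Gamma0 N) k ℓ - μ • (1 : Module.End ℂ (CuspForm (Gamma0 N) k))) ^ n) h = 0) :
    heckeT (Gamma0 N) k ℓ h = μ • h := by
  set T : Module.End ℂ (CuspForm (Gamma0 N) k) := heckeT (Gamma0 N) k ℓ with hT
  have hgen : T.maxGenEigenspace μ = T.eigenspace μ :=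
    maxGenEigenspace_eq_eigenspace_of_selfAdjoint
      (fun x y ↦ peterssonProduct (Gamma0 N) k x y)
      (fun u v w ↦ peterssonProduct_add_right k u v w)
      (fun c v w ↦ peterssonProduct_smul_right (Gamma0 N) k c v w)
      (fun v w ↦ peterssonProduct_conj_symm_holds (Gamma0 N) k v w)
      (fun v hv ↦ eq_zero_of_peterssonProduct_self_eq_zero k v hv)
      T (fun v w ↦ heckeT_selfAdjoint_holds N k ℓ hℓ hℓN v w) μ
  have hmem : h ∈ T.maxGenEigenspace μ := (Module.End.mem_maxGenEigenspace T μ h).mpr ⟨n, hn⟩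
  rw [hgen, Module.End.mem_eigenspace_iff] at hmem
  exact hmem

omit [NeZero N] in
/-- `ι₁ = id` on `S_k(Γ₀(N))` (`a_n(ι₁ f) = a_n(f)`). [cite: DiamondShurman2005, §5.7 (ι_d on Fourier expansions)] -/
theorem iota_one_eq [NeZero N] (h : N * 1 ∣ N) (f : CuspForm (Gamma0 N) k) : iota N N 1 k h f = f := by
  refine eq_of_forall_cuspCoeff_eq_gamma0 fun n ↦ ?_
  simp only [cuspCoeff, qExpansion_coeff_iota, one_dvd, if_true, Nat.div_one]

/-- The exceptional set of primes at which two eigenvalue systems agreeing off `L` may differ is finite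
(it is contained in the prime divisors of `L`). [folklore] -/
theorem finite_setOf_prime_and_ne {L : ℕ} (hL : L ≠ 0) {a b : ℕ → ℂ}
    (hab : ∀ p : ℕ, p.Prime → ¬ p ∣ L → a p = b p) :
    {p : ℕ | p.Prime ∧ a p ≠ b p}.Finite := by
  refine (Finset.finite_toSet L.divisors).subset fun p hp ↦ ?_
  obtain ⟨hp1, hp2⟩ := hp
  rw [Finset.mem_coe, Nat.mem_divisors]
  exact ⟨by_contra fun hpL ↦ hp2 (hab p hp1 hpL), hL⟩

/-- **(R2a) Vatsal's Condition 1 holds for every newform on `Γ₀(N)`** («The first condition will be satisfied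
if, for example, both `f` and `g` are new of level `M`»): every `h ∈ S_k(Γ₀(N))` killed by a power of
`T_ℓ − a_ℓ(f)` for every prime `ℓ` is a multiple of the newform `f`. Proof: off `N` the generalised
eigen-equations are honest (§1), so `h ≠ 0` lies in the span of the old forms `[α_d] g̃`, `M d ∣ N`, of ONE newform
`g̃` of level `M ∣ N` with the eigenvalue packet of `f` off `N` (Atkin–Lehner basis,
`exists_isNewform0_mem_span_of_eigenpacket`); strong multiplicity one across levels forces `M = N` and `g̃ = f`
(`IsNewform0.level_eq_of_heckeEigenvalue_eq_holds`, `IsNewform0.eq_of_heckeEigenvalue_eq_holds`), and `N d ∣ N`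
forces `d = 1`, `[α_1] f = f`. [cite: Vatsal1999, (1.2) Condition 1] [cite: AtkinLehner1970, Thm. 4 and Thm. 5]
[cite: DiamondShurman2005, Thm. 5.8.3] -/
theorem hasSimpleHeckeGenEigenspace_of_isNewform0 {f : CuspForm (Gamma0 N) 2} (hf : IsNewform0 f) :
    HasSimpleHeckeGenEigenspace f := by
  intro h hh
  by_cases h0 : h = 0
  · exact ⟨0, by rw [h0, zero_smul]⟩
  -- off `N` the generalised eigen-equations are honest, with eigenvalues `a_ℓ(f)`
  have hT : ∀ (ℓ : ℕ) (hℓ : ℓ.Prime), ¬ ℓ ∣ N →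
      (haveI : NeZero ℓ := ⟨hℓ.ne_zero⟩; heckeT (Gamma0 N) 2 ℓ h) = (qExpansion 1 ⇑f).coeff ℓ • h := by
    intro ℓ hℓ hℓN
    haveI : NeZero ℓ := ⟨hℓ.ne_zero⟩
    obtain ⟨n, hn⟩ := hh ℓ hℓ
    rw [heckeEigenvalue_eq_coeff_of_isNormalized hf.2.2 hℓ (hf.2.1 ℓ hℓ)] at hn
    exact heckeT_apply_eq_smul_of_pow_apply_eq_zero hℓ hℓN hn
  obtain ⟨M, _, hMN, g, hg, hcoef, hmem⟩ := exists_isNewform0_mem_span_of_eigenpacket h0 hT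
  -- strong multiplicity one: `M = N`, `g = f`
  have hfg : ∀ p : ℕ, p.Prime → ¬ p ∣ N → heckeEigenvalue f p = heckeEigenvalue g p := by
    intro p hp hpN
    rw [heckeEigenvalue_eq_coeff_of_isNormalized hf.2.2 hp (hf.2.1 p hp),
      heckeEigenvalue_eq_coeff_of_isNormalized hg.2.2 hp (hg.2.1 p hp), hcoef p hp hpN]
  have hNM : N = M :=
    IsNewform0.level_eq_of_heckeEigenvalue_eq_holds hf hg (finite_setOf_prime_and_ne (NeZero.ne N) hfg)
  subst hNM
  have hgf : g = f :=
    (IsNewform0.eq_of_heckeEigenvalue_eq_holds hf hg (finite_setOf_prime_and_ne (NeZero.ne N) hfg)).symm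
  subst hgf
  -- `N d ∣ N` forces `d = 1`, and `[α_1] g = g`
  have hle : Submodule.span ℂ {v | ∃ (d : ℕ) (_ : NeZero d), N * d ∣ N ∧ v = degeneracyMap0 N N d 2 g} ≤
      Submodule.span ℂ {g} := by
    refine Submodule.span_le.mpr ?_
    rintro _ ⟨d, _, hd, rfl⟩
    have hd1 : d = 1 := by
      have hN0 : 0 < N := NeZero.pos N
      have h1 : N * d ≤ N * 1 := by rw [mul_one]; exact Nat.le_of_dvd hN0 hd
      have h2 : 1 ≤ d := NeZero.pos d
      have h3 := Nat.le_of_mul_le_mul_left h1 hN0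
      omega
    subst hd1
    rw [SetLike.mem_coe, degeneracyMap0_eq_smul_iota N N 1 2 hd, iota_one_eq hd]
    exact Submodule.smul_mem _ _ (Submodule.mem_span_singleton_self g)
  obtain ⟨c, hc⟩ := Submodule.mem_span_singleton.mp (hle hmem)
  exact ⟨c, hc.symm⟩

end Newform

/-! ### §2 Condition 1 for the `q`-stabilised form `ι₁ g − β ι_q g` when `α ≠ β` -/

section Stab

/-- Powers of `U − a` on an eigenvector: `U v = μ v ⟹ (U − a)ⁿ v = (μ − a)ⁿ v`. [folklore] -/
theorem pow_sub_smul_one_apply_of_eigen {V : Type*} [AddCommGroup V] [Module ℂ V] (U : Module.End ℂ V)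
    {v : V} {μ : ℂ} (hv : U v = μ • v) (a : ℂ) (n : ℕ) :
    ((U - a • (1 : Module.End ℂ V)) ^ n) v = (μ - a) ^ n • v := by
  induction n with
  | zero => rw [pow_zero, pow_zero, Module.End.one_apply, one_smul]
  | succ n ih =>
    rw [pow_succ, Module.End.mul_apply, LinearMap.sub_apply, LinearMap.smul_apply, Module.End.one_apply, hv,
      ← sub_smul, map_smul, ih, smul_smul, ← pow_succ']

variable {M q : ℕ} [NeZero M] [NeZero q] [NeZero (M * q)] {g : CuspForm (Gamma0 M) 2} (hg : IsNewform0 g)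
  (β : ℂ) (h1 : M * 1 ∣ M * q) (hMq : M * q ∣ M * q)
include hg

/-- The Hecke eigenvalues of the stabilised form: `a_ℓ(g)` for `ℓ ≠ q`, `α = a_q(g) − β` at `q`.
[cite: DiamondShurman2005, §5.7 (ι_d on Fourier expansions)] -/
theorem heckeEigenvalue_stab (hq : q.Prime) (hqM : ¬ q ∣ M) (hβ : β ^ 2 - cuspCoeff g q * β + q = 0) {ℓ : ℕ}
    (hℓ : ℓ.Prime) :
    heckeEigenvalue (iota M (M * q) 1 2 h1 g - β • iota M (M * q) q 2 hMq g) ℓ =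
      if ℓ = q then cuspCoeff g q - β else cuspCoeff g ℓ := by
  rw [heckeEigenvalue_eq_coeff_of_isNormalized (isNormalized_stab g β h1 hMq hg.2.2 hq) hℓ
    (isHeckeEigenform_stab hg β h1 hMq hq hqM hβ ℓ hℓ)]
  exact cuspCoeff_stab_prime hg β h1 hMq hq hℓ

/-- **(R2b) Vatsal's Condition 1 for the `q`-stabilised old form `g' = ι₁ g − β ι_q g ∈ S₂(Γ₀(Mq))` of a
newform `g ∈ S₂(Γ₀(M))`, `q ∤ M` prime, `β² − a_q(g)β + q = 0`, WHEN the two roots `α = a_q(g) − β` and `β`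
are DISTINCT.** A generalised eigenvector `h` for the eigencharacter of `g'` is an honest `T_ℓ`-eigenvector at
`ℓ ∤ Mq` (§1), so it lies in the span of the old forms of one newform with the packet of `g` off `Mq`
(`exists_isNewform0_mem_span_of_eigenpacket`), which is `g` itself (strong multiplicity one across levels);
the old forms `[α_d] g`, `M d ∣ M q`, are `ι₁ g` and `q ι_q g`, and the plane `ℂι₁ g + ℂι_q g = ℂ g'_β + ℂ g'_α`
carries `U_q g'_β = α g'_β`, `U_q g'_α = β g'_α` (`heckeT_stab_self`); a power of `U_q − α` kills `h` only if
its `g'_α`-coordinate vanishes. («can often be checked in other situations», Vatsal p. 398: here the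
`q`-old space with `U_q` semisimple.) [cite: Vatsal1999, (1.2) Condition 1] [cite: AtkinLehner1970, Thm. 4 and Thm. 5]
[cite: DiamondShurman2005, Prop. 5.6.2 and Thm. 5.8.3] -/
theorem hasSimpleHeckeGenEigenspace_stab_of_ne (hq : q.Prime) (hqM : ¬ q ∣ M)
    (hβ : β ^ 2 - cuspCoeff g q * β + q = 0) (hαβ : cuspCoeff g q - β ≠ β) :
    HasSimpleHeckeGenEigenspace (iota M (M * q) 1 2 h1 g - β • iota M (M * q) q 2 hMq g) := by
  set α : ℂ := cuspCoeff g q - β with hαdef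
  set g' := iota M (M * q) 1 2 h1 g - β • iota M (M * q) q 2 hMq g with hg'def
  set g'' := iota M (M * q) 1 2 h1 g - α • iota M (M * q) q 2 hMq g with hg''def
  have hα : α ^ 2 - cuspCoeff g q * α + q = 0 := by rw [hαdef]; linear_combination hβ
  have haα : cuspCoeff g q - α = β := by rw [hαdef]; ring
  -- the two `U_q`-eigenvectors of the old plane
  have hU' : heckeT (Gamma0 (M * q)) 2 q g' = α • g' := heckeT_stab_self hg β h1 hMq hq hqM hβ
  have hU'' : heckeT (Gamma0 (M * q)) 2 q g'' = β • g'' := by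
    rw [hg''def, heckeT_stab_self hg α h1 hMq hq hqM hα, haα]
  have hg''0 : g'' ≠ 0 := (isNormalized_stab g α h1 hMq hg.2.2 hq).ne_zero
  intro h hh
  by_cases h0 : h = 0
  · exact ⟨0, by rw [h0, zero_smul]⟩
  -- off `Mq` the generalised eigen-equations are honest, with eigenvalues `a_ℓ(g)`
  have hT : ∀ (ℓ : ℕ) (hℓ : ℓ.Prime), ¬ ℓ ∣ M * q →
      (haveI : NeZero ℓ := ⟨hℓ.ne_zero⟩; heckeT (Gamma0 (M * q)) 2 ℓ h) = (qExpansion 1 ⇑g).coeff ℓ • h := by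
    intro ℓ hℓ hℓL
    haveI : NeZero ℓ := ⟨hℓ.ne_zero⟩
    have hℓq : ℓ ≠ q := by rintro rfl; exact hℓL (dvd_mul_left ℓ M)
    obtain ⟨n, hn⟩ := hh ℓ hℓ
    rw [heckeEigenvalue_stab hg β h1 hMq hq hqM hβ hℓ, if_neg hℓq] at hn
    exact heckeT_apply_eq_smul_of_pow_apply_eq_zero hℓ hℓL hn
  obtain ⟨M', _, hM'L, g₁, hg₁, hcoef, hmem⟩ := exists_isNewform0_mem_span_of_eigenpacket h0 hT
  -- strong multiplicity one: `M' = M`, `g₁ = g`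
  have hfg : ∀ p : ℕ, p.Prime → ¬ p ∣ M * q → heckeEigenvalue g p = heckeEigenvalue g₁ p := by
    intro p hp hpL
    rw [heckeEigenvalue_eq_coeff_of_isNormalized hg.2.2 hp (hg.2.1 p hp),
      heckeEigenvalue_eq_coeff_of_isNormalized hg₁.2.2 hp (hg₁.2.1 p hp), hcoef p hp hpL]
  have hfin : {p : ℕ | p.Prime ∧ heckeEigenvalue g p ≠ heckeEigenvalue g₁ p}.Finite :=
    finite_setOf_prime_and_ne (NeZero.ne (M * q)) hfg
  have hMM' : M = M' := IsNewform0.level_eq_of_heckeEigenvalue_eq_holds hg hg₁ hfin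
  subst hMM'
  have hg₁g : g₁ = g := (IsNewform0.eq_of_heckeEigenvalue_eq_holds hg hg₁ hfin).symm
  subst hg₁g
  -- the old forms `[α_d] g₁`, `M d ∣ M q`, lie in the plane `P = ℂ g' + ℂ g''`
  set P : Submodule ℂ (CuspForm (Gamma0 (M * q)) 2) := Submodule.span ℂ {g', g''} with hPdef
  have hg'P : g' ∈ P := Submodule.subset_span (Set.mem_insert _ _)
  have hg''P : g'' ∈ P := Submodule.subset_span (Set.mem_insert_of_mem _ (Set.mem_singleton _))
  have hαβ' : α - β ≠ 0 := sub_ne_zero.mpr hαβ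
  have hdiff : g' - g'' = (α - β) • iota M (M * q) q 2 hMq g₁ := by
    rw [hg'def, hg''def, sub_sub_sub_cancel_left, ← sub_smul]
  have hιq : iota M (M * q) q 2 hMq g₁ ∈ P := by
    have he : iota M (M * q) q 2 hMq g₁ = (α - β)⁻¹ • (g' - g'') := by
      rw [hdiff, smul_smul, inv_mul_cancel₀ hαβ', one_smul]
    rw [he]
    exact P.smul_mem _ (P.sub_mem hg'P hg''P)
  have hι1 : iota M (M * q) 1 2 h1 g₁ ∈ P := by
    have he : iota M (M * q) 1 2 h1 g₁ = g' + β • iota M (M * q) q 2 hMq g₁ := by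
      rw [hg'def, sub_add_cancel]
    rw [he]
    exact P.add_mem hg'P (P.smul_mem _ hιq)
  have hle : Submodule.span ℂ
      {v | ∃ (d : ℕ) (_ : NeZero d), M * d ∣ M * q ∧ v = degeneracyMap0 M (M * q) d 2 g₁} ≤ P := by
    refine Submodule.span_le.mpr ?_
    rintro _ ⟨d, _, hd, rfl⟩
    have hdq : d ∣ q := Nat.dvd_of_mul_dvd_mul_left (NeZero.pos M) hd
    rw [SetLike.mem_coe, degeneracyMap0_eq_smul_iota M (M * q) d 2 hd]
    rcases (Nat.dvd_prime hq).mp hdq with rfl | rfl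
    · rw [iota_congr rfl hd h1 g₁]
      exact P.smul_mem _ hι1
    · rw [iota_congr rfl hd hMq g₁]
      exact P.smul_mem _ hιq
  obtain ⟨c₁, c₂, hc⟩ := Submodule.mem_span_pair.mp (hle hmem)
  -- a power of `U_q − α` kills `h`: its `g''`-coordinate vanishes
  obtain ⟨n, hn⟩ := hh q hq
  rw [heckeEigenvalue_stab hg β h1 hMq hq hqM hβ hq, if_pos rfl] at hn
  rcases Nat.eq_zero_or_pos n with rfl | hnpos
  · rw [pow_zero, Module.End.one_apply] at hn
    exact absurd hn h0
  rw [← hc, map_add, map_smul, map_smul, pow_sub_smul_one_apply_of_eigen _ hU' α n,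
    pow_sub_smul_one_apply_of_eigen _ hU'' α n, sub_self, zero_pow hnpos.ne', zero_smul, smul_zero, zero_add,
    smul_smul, smul_eq_zero] at hn
  have hc₂ : c₂ = 0 := by
    rcases hn with hmul | hzero
    · rcases mul_eq_zero.mp hmul with hc | hpow
      · exact hc
      · exact absurd (pow_eq_zero_iff hnpos.ne' |>.mp hpow) (sub_ne_zero.mpr (Ne.symm hαβ))
    · exact absurd hzero hg''0
  refine ⟨c₁, ?_⟩
  rw [← hc, hc₂, zero_smul, add_zero]

end Stab

/-! ### §3 The root `β ≡ q` and the free case `q ≢ 1 (mod 3)` of `α ≠ β` -/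

section Roots

/-- In `𝒪_{ℚ̄₃}`: a product of two integers of norm `< 1` has a factor of norm `< 1`. [folklore] -/
theorem norm_lt_one_or_of_mul {x y : PadicAlgCl 3} (hx : ‖x‖ ≤ 1) (hy : ‖y‖ ≤ 1) (hxy : ‖x * y‖ < 1) :
    ‖x‖ < 1 ∨ ‖y‖ < 1 := by
  by_contra h
  push Not at h
  have hx1 : ‖x‖ = 1 := le_antisymm hx h.1
  have hy1 : ‖y‖ = 1 := le_antisymm hy h.2
  rw [norm_mul, hx1, hy1, mul_one] at hxy
  exact lt_irrefl _ hxy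

/-- **A root `β ≡ q (mod 𝔪)` of `X² − aX + q` when `a` is `3`-integral and `a ≡ q + 1`**: over `ℂ` the
polynomial splits, its roots are integral (`norm_root_le_one`) and reduce to the roots `{1, q}` of
`(X − 1)(X − q) ≡ X² − aX + q`; if the first root is `≢ q` it is `≡ 1` and the second one `a − β₀ ≡ q`. (No
Hensel lifting is needed.) [folklore] -/
theorem exists_root_valuation_sub_lt_one (ι : PadicAlgCl 3 ≃+* ℂ) {a : ℂ} (ha : Valued.v (ι.symm a) ≤ 1)
    (q : ℕ) (haq : Valued.v (ι.symm (a - (q + 1))) < 1) :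
    ∃ β : ℂ, β ^ 2 - a * β + q = 0 ∧ Valued.v (ι.symm (β - q)) < 1 := by
  -- a root `β₀ = (a + s)/2`, `s² = a² − 4q`
  obtain ⟨s, hs⟩ := IsAlgClosed.exists_eq_mul_self (a ^ 2 - 4 * q : ℂ)
  set β₀ : ℂ := (a + s) / 2 with hβ₀
  have hroot : ∀ b : ℂ, b = β₀ ∨ b = a - β₀ → b ^ 2 - a * b + q = 0 := by
    rintro b (rfl | rfl)
    · rw [hβ₀]; linear_combination (-1 / 4 : ℂ) * hs
    · rw [hβ₀]; linear_combination (-1 / 4 : ℂ) * hs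
  have h0 : β₀ ^ 2 - a * β₀ + q = 0 := hroot β₀ (Or.inl rfl)
  -- integrality and the residual factorisation `(x − 1)(x − q) = (a − (q+1))·x`
  have ha' : ‖ι.symm a‖ ≤ 1 := valuation_le_one_iff.mp ha
  have hx : ‖ι.symm β₀‖ ≤ 1 := by
    refine norm_root_le_one (q := q) ha' ?_
    have := congrArg ι.symm h0
    simpa [map_sub, map_add, map_mul, map_pow, map_natCast] using this
  have hq1 : ‖(q : PadicAlgCl 3)‖ ≤ 1 := by
    have := norm_intCast_le_one (q : ℤ); rwa [Int.cast_natCast] at this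
  have hfac : (ι.symm β₀ - 1) * (ι.symm β₀ - q) = ι.symm (a - (q + 1)) * ι.symm β₀ := by
    have := congrArg ι.symm h0
    simp only [map_sub, map_add, map_mul, map_pow, map_natCast, map_zero, map_one] at this ⊢
    linear_combination this
  have hprod : ‖(ι.symm β₀ - 1) * (ι.symm β₀ - q)‖ < 1 := by
    rw [hfac, norm_mul]
    exact mul_lt_one_of_nonneg_of_lt_one_left (norm_nonneg _) (valuation_lt_one_iff.mp haq) hx
  have h1x : ‖ι.symm β₀ - 1‖ ≤ 1 := by
    rw [sub_eq_add_neg]; exact (PadicAlgCl.isNonarchimedean 3 _ _).trans (max_le hx (by rw [norm_neg, norm_one]))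
  have hqx : ‖ι.symm β₀ - q‖ ≤ 1 := by
    rw [sub_eq_add_neg]; exact (PadicAlgCl.isNonarchimedean 3 _ _).trans (max_le hx (by rw [norm_neg]; exact hq1))
  rcases norm_lt_one_or_of_mul h1x hqx hprod with h1 | h2
  · -- `β₀ ≡ 1`: take the other root `a − β₀ ≡ (q + 1) − 1 = q`
    refine ⟨a - β₀, hroot _ (Or.inr rfl), valuation_lt_one_iff.mpr ?_⟩
    have : ι.symm (a - β₀ - q) = ι.symm (a - (q + 1)) - (ι.symm β₀ - 1) := by
      simp only [map_sub, map_add, map_natCast, map_one]; ring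
    rw [this, sub_eq_add_neg]
    refine lt_of_le_of_lt (PadicAlgCl.isNonarchimedean 3 _ _) (max_lt (valuation_lt_one_iff.mp haq) ?_)
    rwa [norm_neg]
  · exact ⟨β₀, h0, valuation_lt_one_iff.mpr (by simpa [map_sub, map_natCast] using h2)⟩

/-- **`α ≠ β` is free when `q ≢ 1 (mod 3)`**: `α = a − β ≡ (q + 1) − q = 1` and `β ≡ q`, so `α = β` would give
`q ≡ 1 (mod 3)`. [folklore] -/
theorem sub_ne_of_mod_three_ne_one (ι : PadicAlgCl 3 ≃+* ℂ) {a β : ℂ} {q : ℕ} (hq3 : q % 3 ≠ 1)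
    (haq : Valued.v (ι.symm (a - (q + 1))) < 1) (hβq : Valued.v (ι.symm (β - q)) < 1) : a - β ≠ β := by
  intro h
  have hq : (((q : ℤ) - 1 : ℤ) : PadicAlgCl 3) = ι.symm (a - (q + 1)) - 2 * ι.symm (β - q) := by
    have ha : a = 2 * β := by linear_combination h
    simp only [map_sub, map_add, map_mul, map_natCast, map_one, map_ofNat, ha]
    push_cast
    ring
  have h2 : ‖(2 : PadicAlgCl 3) * ι.symm (β - q)‖ < 1 := by
    rw [norm_mul]
    have h2' : ‖(2 : PadicAlgCl 3)‖ ≤ 1 := by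
      have := norm_intCast_le_one (2 : ℤ); simpa using this
    exact mul_lt_one_of_nonneg_of_lt_one_right h2' (norm_nonneg _) (valuation_lt_one_iff.mp hβq)
  have hlt : ‖(((q : ℤ) - 1 : ℤ) : PadicAlgCl 3)‖ < 1 := by
    rw [hq, sub_eq_add_neg]
    refine lt_of_le_of_lt (PadicAlgCl.isNonarchimedean 3 _ _) (max_lt (valuation_lt_one_iff.mp haq) ?_)
    rwa [norm_neg]
  rw [show (((q : ℤ) - 1 : ℤ) : PadicAlgCl 3) = ((((q : ℤ) - 1 : ℤ) : ℚ_[3]) : PadicAlgCl 3) by push_cast; rfl,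
    PadicAlgCl.norm_extends, Padic.norm_intCast_lt_one_iff] at hlt
  obtain ⟨c, hc⟩ := hlt
  omega

end Roots

end Summit.BirchSwinnertonDyer.BirchSwinnertonDyer.Theorems.KimAtThreeDeepLowerOffStratumLevelLoweringConditionOne

end
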